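import Summits.MatrixMultiplication.OmegaCensus.BoxNotUsefulLift

/-!
# ω-census, family (b3): conjecture C9 — box-usefulness passes to direct factors and to homomorphic images

HONEST FRAMING (pub-omega census; verbatim): lottery ticket; floor = certified bounds/negative ranges.
Census BOOKKEEPING (conjecture C9 (a) of the cell in homomorphism form; pub-omega stpp-1 gen 18): the contrapositive of
`not_boxUseful_of_surjective` (`BoxNotUsefulLift`) stated positively — `BoxUseful.of_surjective`: a box-useful group has only
box-useful homomorphic images — and its two everyday instances `BoxUseful.of_prod_left / of_prod_right`: a box-useful direct
product has box-useful factors.  (The converse fails in the kernel: `D_8 × S_3`, `D_8 × D_8`, `D_8 × Q_8`, `Q_8 × Q_8` are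
useless products of useful groups — `BoxBadDihedralProduct`, `BoxBadClassProducts`.)  Nothing here is progress on `ω`.
-/

namespace Summit.MatrixMultiplication.OmegaCensus

open Finset ProductBoxBound

variable {G : Type*} [Group G] [Fintype G] [DecidableEq G]

/-- **A homomorphic image of a box-useful group is box-useful.** [folklore] -/
theorem BoxUseful.of_surjective {Q : Type*} [Group Q] [Fintype Q] [DecidableEq Q] (f : G →* Q)
    (hf : Function.Surjective f) (hG : BoxUseful G) : BoxUseful Q := by
  by_contra hQ
  unfold BoxUseful at hQ
  push Not at hQ
  obtain ⟨Y, W, hY, hW, I, hI, hind, hbig⟩ := hQ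
  exact not_boxUseful_of_surjective f hf hY hW hI hind hbig hG

/-- **The first factor of a box-useful direct product is box-useful.** [folklore] -/
theorem BoxUseful.of_prod_left {H : Type*} [Group H] [Fintype H] [DecidableEq H] (h : BoxUseful (G × H)) : BoxUseful G :=
  BoxUseful.of_surjective (MonoidHom.fst G H) Prod.fst_surjective h

/-- **The second factor of a box-useful direct product is box-useful.** [folklore] -/
theorem BoxUseful.of_prod_right {H : Type*} [Group H] [Fintype H] [DecidableEq H] (h : BoxUseful (G × H)) : BoxUseful H :=
  BoxUseful.of_surjective (MonoidHom.snd G H) Prod.snd_surjective h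

end Summit.MatrixMultiplication.OmegaCensus
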